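import Literature.MathematicalPhysics.QuantumFieldTheory.Balaban1983to89.B3Ineq210MixedRegularRegion
import Literature.MathematicalPhysics.QuantumFieldTheory.Balaban1983to89.B3Ineq210RegularBox

/-!
# Bałaban, *(Higgs)₂,₃ quantum fields in a finite volume III* [B3] — (2.10) p. 426, THE CLAUSE *"for each differentiation, there is an
additional factor (L^jη)^{−1}"* WITH ONE COVARIANT DIFFERENTIATION IN EACH VARIABLE (the kernels `(D^η_{B̃,μ}G^η_{(j)}D^{η*}_{B̃,ν})(Ω,B̃;x,x′)`
of the scale pieces (2.6)) ON A CELL-PRODUCT BOX OF BIG BLOCKS `Ω ⊆ T_η`, AT A REGULAR NON-CONSTANT BACKGROUND `B̃ = A`, AT **EVERY** PAIR OF BONDS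
OF `Ω` (no `R₀`-margin) — PROVED for r14's region pieces `pieceR` and p33's region quantity `mixedTermR`, uniformly in the volume

statement-level skeleton of published theorems with citation tags; proofs where landed; nothing here is a claim about the Yang–Mills mass gap

T. Bałaban, Commun. Math. Phys. **88** (1983) 411–445 [cite: Balaban1983Higgs3]; inputs from part I, Commun. Math. Phys. **85** (1982)
603–636 [cite: Balaban1982Higgs1], as landed in the tree.  PDF held: `paper:balaban1983-higgs-2-3-quantum-fields-finite-volume` p. 426
[PDF 16]; `paper:balaban1982-cmp85-higgs23-i` pp. 610–611 [PDF 8–9].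

CITATION HEADER (lean-in-tree rule).  Cell `lit-balaban` (HOME `run/shared/lean/pub/lit-balaban/`), Phase-2 proof seat **p35** gen 21
(unit `lit-balaban-p35`, free-target protocol G.5-34(d), TAKING HOME/STATUS 2026-08-23T00:55Z and its addendum); SKELETON row
**B3.Eq2.10** (owner r15, head `proved`; LOCATED MEMBER); companion of this seat's `B3Ineq210RegularBox` (value and ONE derivative at every
point/bond of a box) and the BOX TWIN of p33 g58's `B3Ineq210MixedRegularRegion` (big-block unions, INTERIOR points).  Together the two box
files supply, at ALL points and bonds of a cell-product box, the three kernel types of (2.10) — `G`, `DG` (and `GD^*` by the adjoint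
identities of p33's §0), `DGD^*` — that the chain bookkeeping of r14 g19's programme on the analytic half of (1.16) sums over all
intermediate sites (`lit-balaban-r14/DESIGN-B3-116-analytic.md` §2, box step).

## What is printed (p. 426 [PDF 16], verbatim)

*"For the propagators G^η_{(j)} we apply the inequality |G^η_{(j)}(Ω, B̃; x, x′)| ≤ O(1)(L^jη)^{−d+2}e^{−δ₁(L^jη)^{−1}|x−x′|}, (2.10)
and if the propagator is differentiated, then for each differentiation, there is an additional factor (L^jη)^{−1} on the right
side. … They all are obtained by rescaling from the η-lattice to the L^{−j}-lattice and application of Propositions I.2.1 and I.2.3."*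
[Balaban1982Higgs1] p. 611 [PDF 9] l.1–2, verbatim: *«For some simple sets Ω, e.g. for rectangular parallelepipeds, the inequalities hold
without any restrictions on the points x, x′.»*

## What this file proves (`ineq210_mixed_regularBox`), and how

`ε^{−d}Σ_i‖(D^ε_{A,μ}G^η_{(j)}(Ω,A)D^{ε*}_{A,ν})(x, x′)e_i‖ ≤ C(L^jη)^{−d}e^{−δ₁(L^jη)^{−1}|x−x′|}` (p33's `mixedTermR`) for every piece `j` and EVERY
pair of bonds `⟨x, x+εe_μ⟩`, `⟨x′, x′+εe_ν⟩` with both ends in `Ω = cellBox k K₀ S` (the bonds of the Neumann operator of `Ω`), at a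
`δ_A`-regular non-constant background on `Ω` with the SINGLE smallness `L^k·δ_A·|e| ≤ t(K₀)`, every charge, every `L ≥ 2`.  Route = p33's
(= p40's torus route = print's), line by line: both derivatives on the two OUTER factors of each term of (I.2.43), the right one through
p40's dipole source `dip` and the adjointness `(Q_jG^ε_j(Ω))^* = G^ε_j(Ω)Q_j^*` (p33's `abs_coord_QG_dip_le_R`, `coord_QG_dip_eq_zero_R` —
already stated with the bond hypothesis `c₋, c₊ ∈ Ω`), the middle factor by (I.2.34) on `Ω^{(j)} × Ω^{(j)}` (p35 g16
`B1Prop23RegularRegionSmall.prop23_regular_region_small`), the three-kernel convolution (`sum3_le`); the ONE change w.r.t. p33: the (I.2.25)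
derivative input is this seat's `R₀`-free box member `B3Ineq210RegularBox.norm_covDeriv_propagatorK_box_reg_decay_sum` (EVERY bond of `Ω`),
read at every level through `cellBox_eq_cellBox_of_le`, so the engine is re-run with BOND hypotheses (`b₋, b₊ ∈ Ω`, `c₋, c₊ ∈ Ω`) in place
of p33's interior-site predicate (`sum_C_coordQGdip_le_B`, `norm_covDeriv_sandwichR_dip_le_B`, `mixedB_piece_zero_le`, `mixedB_piece_pos_le`;
proofs = p33's, hypothesis shape changed).

## Honest scope

`Ω` a cell-product box of `L^kK₀`-cells in a volume with `K₀ ∣ M` and at least three cubes a side; the claim is about the bonds INSIDE `Ω`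
(nothing about bonds leaving `Ω`, which the Neumann operator does not have); `m² > 0`; constants depend on `K₀` and are chosen after the charge
data; `|·|` of an `N × N` block = column sum over an orthonormal basis.  General big-block unions: p33's `B3Ineq210MixedRegularRegion`
(interior points).  No `def … : Prop`, no new named fact, no new definition; axioms standard.
-/

noncomputable section

open scoped BigOperators InnerProductSpace Matrix

namespace Literature.MathematicalPhysics.QuantumFieldTheory.Balaban1983to89.B3Ineq210MixedRegularBox

open HiggsLattice (ChargeData ScalarField siteInner covDeriv)
open HiggsCovariance (propagatorK avgQkLin avgQkAdj E)
open HiggsAveraging (blockIter)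
open HiggsFluctMeasure (coeff221)
open B1Eq221Coordinates (fieldCoord fieldCoord_apply)
open B1Eq230FluctCov (mat Ix cb fluctCovA cb_repr mat_mulVec)
open B1Ineq234Concrete (profile profile_nonneg' nCol)
open B1TorusCubeCover (half)
open B1TorusRegionHSizes (IsBigBlockUnion)
open B1TorusRegionRop (chi)
open B2Eq337ScalarIntegration (Regions)
open B2Eq328ConcretePieces (pieceF)
open B3Ineq210RegularTorus (norm_avgQkAdj_cb_le blockIter_eq_of_avgQkAdj_cb_ne_zero blockDist_le_tdist sum3_le exp_blockIter_le
  norm_apply_le_sum_coord norm_covDeriv_apply_le_sum_coord abs_mat_le_norm norm_cb_le mesh_eq_pow_mul card_Ix eq_of_cb_ne_zero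
  aSeq_sq_le covDeriv_smul'' covDeriv_zero'' mesh_mono)
open B3Ineq210RegularRegion (levelSet sandwichR pieceR pieceR_zero pieceR_of_pos pieceR_of_le G_avgQkAdj_cb_eq_zero
  mat_QG_eq_R blockUnion_of_isBigBlockUnion isBigBlockUnion_of_le reg223R_of_small half_mono
  propagatorK_apply_eq_chi towerR pieceF_towerR levelSet_blockUnion mat_condCov232_levelSet)
open B3Ineq210MixedRegularTorus (onb norm_onb dip norm_dip_le dip_eq_zero_of_ne sum_inner_dip fieldCoord_dip_dotProduct siteInner_dip
  norm_covDeriv_dip_le_sum dip_support_dist cstMix cstMix_pos le_cstMix_zero le_cstMix_pos abs_fieldCoord_apply_le)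
open B3Ineq210MixedRegularRegion (abs_coord_QG_dip_le_R covDeriv_G_avgQkAdj_cb_eq_zero_R coord_QG_dip_eq_zero_R mixedTermR
  mixedTermR_nonneg mixedTermR_eq_zero_of_le)
open B1Ineq225RegularBox (cellBox isBigBlockUnion_cellBox)
open B3Ineq210RegularBox (refineS cellBox_eq_cellBox_of_le norm_covDeriv_G_avgQkAdj_cb_le_B norm_covDeriv_propagatorK_box_reg_decay_sum)

variable {P : HiggsLattice.Params} {N : ℕ}

/-! ## §1 p33's dipole engine on a region with BOND hypotheses (`b₋, b₊ ∈ Ω`, `c₋, c₊ ∈ Ω`) -/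

section EngineB

variable (C : ChargeData N) (Ω : Finset (HiggsLattice.Site P 0)) (A : HiggsLattice.VecField P 0) (msq a : ℝ) {l : ℕ}

/-- **The middle sum on a region, dipole source at a bond of `Ω`**: p33's `sum_C_coordQGdip_le_R` with the (I.2.25) derivative input on the
BONDS of `Ω` and the dipole bond `c ⊂ Ω` (both ends) in place of an interior source point. [cite: Balaban1982Higgs1, Prop. 2.1 (2.25) p.610,
p.611 l.1–2, Prop. 2.3 (2.34) p.611] -/
theorem sum_C_coordQGdip_le_B (hl : l ≤ P.K) (hmsq : 0 < msq) (hak : 0 ≤ B1.aSeq a P.L l)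
    (hΩ : ∀ x x' : HiggsLattice.Site P 0, blockIter l x = blockIter l x' → (x ∈ Ω ↔ x' ∈ Ω))
    {cD cC δ : ℝ} (hcD : 0 ≤ cD) (hcC : 0 ≤ cC) (hδ : 0 ≤ δ)
    (hDG : ∀ (g : ScalarField P 0 N) (M D : ℝ), (∀ x, ‖g x‖ ≤ M) → 0 ≤ D →
      ∀ b : HiggsLattice.PBond P 0, b.src ∈ Ω → b.tgt ∈ Ω → (∀ z, g z ≠ 0 → D ≤ (HiggsLattice.Site.tdist b.src z : ℝ)) →
        ‖covDeriv C A (propagatorK C Ω A msq a l g) b‖ ≤ cD * Real.exp (-(δ * (D / (P.L : ℝ) ^ l))) * M)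
    (hC : ∀ s t : HiggsLattice.Site P l × Ix N, s.1 ∈ levelSet l Ω → t.1 ∈ levelSet l Ω →
      |mat (fluctCovA C Ω A msq a l) s t| ≤ cC * Real.exp (-(δ * (HiggsLattice.Site.tdist s.1 t.1 : ℝ))))
    {s : HiggsLattice.Site P l × Ix N} (hs : s.1 ∈ levelSet l Ω) {c : HiggsLattice.PBond P 0} (hc : c.src ∈ Ω) (hc' : c.tgt ∈ Ω)
    (w : E N) :
    ∑ t : HiggsLattice.Site P l × Ix N, |mat (fluctCovA C Ω A msq a l) s t| *
        |fieldCoord (E N) (HiggsLattice.Site P l) (avgQkLin C A l (propagatorK C Ω A msq a l (dip C A c w))) t|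
      ≤ ∑ t : HiggsLattice.Site P l × Ix N, cC * Real.exp (-(δ * (HiggsLattice.Site.tdist s.1 t.1 : ℝ))) *
          ((((P.L : ℝ) ^ l) ^ P.d)⁻¹ * (P.mesh 0 * (‖w‖ *
            (cD * Real.exp δ * Real.exp (-(δ * (HiggsLattice.Site.tdist (blockIter l c.src) t.1 : ℝ))) * Real.sqrt N)))) := by
  refine Finset.sum_le_sum fun t _ => ?_
  by_cases ht : t.1 ∈ levelSet l Ω
  · refine mul_le_mul (hC s t hs ht) ((abs_coord_QG_dip_le_R C Ω A msq a c w t).trans ?_) (abs_nonneg _) (by positivity)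
    refine mul_le_mul_of_nonneg_left (mul_le_mul_of_nonneg_left (mul_le_mul_of_nonneg_left ?_ (norm_nonneg _))
      (P.mesh_pos 0).le) (inv_nonneg.mpr (by positivity))
    exact norm_covDeriv_G_avgQkAdj_cb_le_B C Ω A msq a hl hcD hδ hDG t hc hc'
  · rw [coord_QG_dip_eq_zero_R C Ω A msq a hmsq hak hΩ t ht hc hc' w, abs_zero, mul_zero]
    have hm0 : 0 ≤ P.mesh 0 := (P.mesh_pos 0).le
    positivity

/-- **THE SANDWICH ON A DIPOLE, DIFFERENTIATED, ON A REGION, AT TWO BONDS OF `Ω`** — p33's `norm_covDeriv_sandwichR_dip_le` with the bond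
hypotheses `b₋, b₊ ∈ Ω`, `c₋, c₊ ∈ Ω` in place of interior source points: `‖(D^ε_A G^ε_l(Ω)Q_l^*C^{(l)}(Ω)Q_lG^ε_l(Ω) dip_c w)(b)‖ ≤
(c_De^{δ}√N)²·c_C·L^{−ld}·K(δ/2)²·e^{δ/2}·ε‖w‖·e^{−(δ/2)|b₋ − c₋|/L^l}`.  Proof = p33's, line by line.
[cite: Balaban1982Higgs1, (2.43) p.612, Prop. 2.1 (2.25) p.610, p.611 l.1–2, Prop. 2.3 (2.34) p.611] [cite: Balaban1983Higgs3, (2.10) p.426] -/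
theorem norm_covDeriv_sandwichR_dip_le_B (hl : l ≤ P.K) (hmsq : 0 < msq) (hak : 0 ≤ B1.aSeq a P.L l)
    (hΩ : ∀ x x' : HiggsLattice.Site P 0, blockIter l x = blockIter l x' → (x ∈ Ω ↔ x' ∈ Ω))
    {cD cC δ : ℝ} (hcD : 0 ≤ cD) (hcC : 0 ≤ cC) (hδ : 0 < δ)
    (hDG : ∀ (g : ScalarField P 0 N) (M D : ℝ), (∀ x, ‖g x‖ ≤ M) → 0 ≤ D →
      ∀ b : HiggsLattice.PBond P 0, b.src ∈ Ω → b.tgt ∈ Ω → (∀ z, g z ≠ 0 → D ≤ (HiggsLattice.Site.tdist b.src z : ℝ)) →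
        ‖covDeriv C A (propagatorK C Ω A msq a l g) b‖ ≤ cD * Real.exp (-(δ * (D / (P.L : ℝ) ^ l))) * M)
    (hC : ∀ s t : HiggsLattice.Site P l × Ix N, s.1 ∈ levelSet l Ω → t.1 ∈ levelSet l Ω →
      |mat (fluctCovA C Ω A msq a l) s t| ≤ cC * Real.exp (-(δ * (HiggsLattice.Site.tdist s.1 t.1 : ℝ))))
    {c : HiggsLattice.PBond P 0} (hc : c.src ∈ Ω) (hc' : c.tgt ∈ Ω) (w : E N)
    {b : HiggsLattice.PBond P 0} (hb : b.src ∈ Ω) (hb' : b.tgt ∈ Ω) :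
    ‖covDeriv C A (sandwichR C Ω A msq a l (dip C A c w)) b‖
      ≤ (cD * Real.exp δ * Real.sqrt N) ^ 2 * cC * (((P.L : ℝ) ^ l) ^ P.d)⁻¹ * profile P N (δ / 2) ^ 2 * Real.exp (δ / 2) *
          (P.mesh 0 * ‖w‖) * Real.exp (-(δ / 2 * ((HiggsLattice.Site.tdist b.src c.src : ℝ) / (P.L : ℝ) ^ l))) := by
  have h0 : sandwichR C Ω A msq a l (dip C A c w) = (propagatorK C Ω A msq a l ∘ₗ avgQkAdj C A l)
      (fluctCovA C Ω A msq a l (avgQkLin C A l (propagatorK C Ω A msq a l (dip C A c w)))) := by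
    simp only [sandwichR, LinearMap.comp_apply]
  rw [h0]
  refine (norm_covDeriv_apply_le_sum_coord C A _ _ b).trans ?_
  have hK : 0 ≤ profile P N (δ / 2) := profile_nonneg' _ (by linarith)
  have hm0 : 0 < P.mesh 0 := P.mesh_pos 0
  have hεw : 0 ≤ P.mesh 0 * ‖w‖ := mul_nonneg hm0.le (norm_nonneg _)
  rcases isEmpty_or_nonempty (Ix N) with hN | ⟨⟨i₀⟩⟩
  · rw [Finset.univ_eq_empty, Finset.sum_empty]
    exact mul_nonneg (mul_nonneg (mul_nonneg (mul_nonneg (mul_nonneg (mul_nonneg (sq_nonneg _) hcC)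
      (inv_nonneg.mpr (by positivity))) (sq_nonneg _)) (Real.exp_pos _).le) hεw) (Real.exp_pos _).le
  calc ∑ s : HiggsLattice.Site P l × Ix N, |fieldCoord (E N) (HiggsLattice.Site P l)
            (fluctCovA C Ω A msq a l (avgQkLin C A l (propagatorK C Ω A msq a l (dip C A c w)))) s| *
          ‖covDeriv C A ((propagatorK C Ω A msq a l ∘ₗ avgQkAdj C A l) (cb P N l s)) b‖
      ≤ ∑ s : HiggsLattice.Site P l × Ix N,
          (∑ t : HiggsLattice.Site P l × Ix N, cC * Real.exp (-(δ * (HiggsLattice.Site.tdist s.1 t.1 : ℝ))) *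
            ((((P.L : ℝ) ^ l) ^ P.d)⁻¹ * (P.mesh 0 * (‖w‖ *
              (cD * Real.exp δ * Real.exp (-(δ * (HiggsLattice.Site.tdist (blockIter l c.src) t.1 : ℝ))) * Real.sqrt N))))) *
          (cD * Real.exp δ * Real.exp (-(δ * (HiggsLattice.Site.tdist (blockIter l b.src) s.1 : ℝ))) * Real.sqrt N) := by
        refine Finset.sum_le_sum fun s _ => ?_
        by_cases hs : s.1 ∈ levelSet l Ω
        · have h1 : |fieldCoord (E N) (HiggsLattice.Site P l)
              (fluctCovA C Ω A msq a l (avgQkLin C A l (propagatorK C Ω A msq a l (dip C A c w)))) s|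
              ≤ ∑ t : HiggsLattice.Site P l × Ix N, cC * Real.exp (-(δ * (HiggsLattice.Site.tdist s.1 t.1 : ℝ))) *
                ((((P.L : ℝ) ^ l) ^ P.d)⁻¹ * (P.mesh 0 * (‖w‖ *
                  (cD * Real.exp δ * Real.exp (-(δ * (HiggsLattice.Site.tdist (blockIter l c.src) t.1 : ℝ))) * Real.sqrt N)))) :=
            (abs_fieldCoord_apply_le (fluctCovA C Ω A msq a l) _ s).trans
              (sum_C_coordQGdip_le_B C Ω A msq a hl hmsq hak hΩ hcD hcC hδ.le hDG hC hs hc hc' w)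
          have h2 : ‖covDeriv C A ((propagatorK C Ω A msq a l ∘ₗ avgQkAdj C A l) (cb P N l s)) b‖
              ≤ cD * Real.exp δ * Real.exp (-(δ * (HiggsLattice.Site.tdist (blockIter l b.src) s.1 : ℝ))) * Real.sqrt N := by
            rw [LinearMap.comp_apply]
            exact norm_covDeriv_G_avgQkAdj_cb_le_B C Ω A msq a hl hcD hδ.le hDG s hb hb'
          exact mul_le_mul h1 h2 (norm_nonneg _) (Finset.sum_nonneg fun t _ => by positivity)
        · have hz : ‖covDeriv C A ((propagatorK C Ω A msq a l ∘ₗ avgQkAdj C A l) (cb P N l s)) b‖ = 0 := by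
            rw [LinearMap.comp_apply, covDeriv_G_avgQkAdj_cb_eq_zero_R C Ω A msq a hmsq hak hΩ s hs hb hb', norm_zero]
          rw [hz, mul_zero]
          exact mul_nonneg (Finset.sum_nonneg fun t _ => by positivity) (by positivity)
    _ = (cD * Real.exp δ * Real.sqrt N) ^ 2 * cC * (((P.L : ℝ) ^ l) ^ P.d)⁻¹ * (P.mesh 0 * ‖w‖) *
          ∑ s : HiggsLattice.Site P l × Ix N, ∑ t : HiggsLattice.Site P l × Ix N,
            Real.exp (-(δ * (HiggsLattice.Site.tdist (blockIter l b.src) s.1 : ℝ))) *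
              Real.exp (-(δ * (HiggsLattice.Site.tdist s.1 t.1 : ℝ))) *
              Real.exp (-(δ * (HiggsLattice.Site.tdist (blockIter l c.src) t.1 : ℝ))) := by
        rw [Finset.mul_sum]
        refine Finset.sum_congr rfl fun s _ => ?_
        rw [Finset.sum_mul, Finset.mul_sum]
        refine Finset.sum_congr rfl fun t _ => ?_
        ring
    _ ≤ (cD * Real.exp δ * Real.sqrt N) ^ 2 * cC * (((P.L : ℝ) ^ l) ^ P.d)⁻¹ * (P.mesh 0 * ‖w‖) *
          (profile P N (δ / 2) ^ 2 *
            Real.exp (-(δ / 2 * (HiggsLattice.Site.tdist (blockIter l b.src) (blockIter l c.src) : ℝ)))) :=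
        mul_le_mul_of_nonneg_left (sum3_le hδ (blockIter l b.src) (blockIter l c.src) i₀) (by positivity)
    _ ≤ (cD * Real.exp δ * Real.sqrt N) ^ 2 * cC * (((P.L : ℝ) ^ l) ^ P.d)⁻¹ * (P.mesh 0 * ‖w‖) *
          (profile P N (δ / 2) ^ 2 * (Real.exp (δ / 2) *
            Real.exp (-(δ / 2 * ((HiggsLattice.Site.tdist b.src c.src : ℝ) / (P.L : ℝ) ^ l))))) :=
        mul_le_mul_of_nonneg_left (mul_le_mul_of_nonneg_left (exp_blockIter_le hl hδ.le b.src c.src) (pow_nonneg hK 2))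
          (by positivity)
    _ = _ := by ring

end EngineB

/-! ## §2 The pieces: p33's `mixedTermR` piece by piece, at two bonds of `Ω` -/

section PieceBoundsB

variable (C : ChargeData N) (Ω : Finset (HiggsLattice.Site P 0)) (A : HiggsLattice.VecField P 0) (msq : ℝ) {a : ℝ} {k j : ℕ}

/-- scaling bookkeeping: `ε^{−d}·L^{−jd} = (L^jε)^{−d}` (p33's/r14's, private there). [cite: Balaban1982Higgs1, (1.19) p.607] -/
private theorem inv_mesh_zero_pow_mul' (j : ℕ) :
    (P.mesh 0 ^ P.d)⁻¹ * (((P.L : ℝ) ^ j) ^ P.d)⁻¹ = (P.mesh j ^ P.d)⁻¹ := by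
  rw [mesh_eq_pow_mul P j, mul_pow, mul_inv, mul_comm]

/-- **Box piece `j = 0`** at a bond `⟨x, x+εe_μ⟩ ⊂ Ω`: `ε^{−d}Σ_i‖(D^ε_AG^ε_1(Ω,A)D^{ε*}_A)(x,x′)e_i‖ ≤ 2N·c₀′L·e^{ρ}·ε^{−d}·e^{−ρ|x − x′|/L}` from the
(I.2.25) derivative clause at level `1` ON THE BONDS OF `Ω`, on the dipole source (p33's `mixedR_piece_zero_le` with the bond hypothesis; `x′`
arbitrary). [cite: Balaban1983Higgs3, (2.6) p.424, (2.10) p.426] [cite: Balaban1982Higgs1, Prop. 2.1 (2.25) p.610, p.611 l.1–2] -/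
theorem mixedB_piece_zero_le {c₀' ρ : ℝ} (hc₀' : 0 ≤ c₀') (hρ : 0 ≤ ρ)
    (hDG : ∀ (g : ScalarField P 0 N) (M D : ℝ), (∀ x, ‖g x‖ ≤ M) → 0 ≤ D →
      ∀ b : HiggsLattice.PBond P 0, b.src ∈ Ω → b.tgt ∈ Ω → (∀ z, g z ≠ 0 → D ≤ (HiggsLattice.Site.tdist b.src z : ℝ)) →
        ‖covDeriv C A (propagatorK C Ω A msq a 1 g) b‖
          ≤ c₀' * P.mesh 1 * Real.exp (-(ρ * (D / (P.L : ℝ) ^ 1))) * M)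
    (μ ν : Fin P.d) {x : HiggsLattice.Site P 0} (hx : x ∈ Ω) (hxμ : x.shift μ ∈ Ω) (x' : HiggsLattice.Site P 0) :
    mixedTermR C Ω A msq a k 0 μ ν x x'
      ≤ ((N : ℝ) * 2 * c₀' * (P.L : ℝ) * Real.exp ρ) * (P.mesh 0 ^ P.d)⁻¹ *
          Real.exp (-(ρ * ((HiggsLattice.Site.tdist x x' : ℝ) / (P.L : ℝ) ^ 1))) := by
  set X := Real.exp (-(ρ * ((HiggsLattice.Site.tdist x x' : ℝ) / (P.L : ℝ) ^ 1))) with hX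
  set D : ℝ := max 0 ((HiggsLattice.Site.tdist x x' : ℝ) - 1) with hD
  have hL1 : (1 : ℝ) ≤ P.L := by exact_mod_cast P.hL
  have hm0 : 0 < P.mesh 0 := P.mesh_pos 0
  have hexp : Real.exp (-(ρ * (D / (P.L : ℝ) ^ 1))) ≤ Real.exp ρ * X := by
    rw [hX, ← Real.exp_add]
    apply Real.exp_le_exp.mpr
    rw [pow_one]
    have hL0 : (0 : ℝ) < P.L := by linarith
    have h1 : (HiggsLattice.Site.tdist x x' : ℝ) - 1 ≤ D := le_max_right _ _
    have h2 : ρ * (((HiggsLattice.Site.tdist x x' : ℝ) - 1) / P.L) ≤ ρ * (D / P.L) :=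
      mul_le_mul_of_nonneg_left (div_le_div_of_nonneg_right h1 hL0.le) hρ
    have h3 : ρ / P.L ≤ ρ := div_le_self hρ hL1
    have h4 : ρ * (((HiggsLattice.Site.tdist x x' : ℝ) - 1) / P.L)
        = ρ * ((HiggsLattice.Site.tdist x x' : ℝ) / P.L) - ρ / P.L := by ring
    linarith
  have h1 : ∀ i : Ix N, ‖covDeriv C A (pieceR C Ω A msq a k 0 (dip C A ⟨x', ν⟩ (onb N i))) ⟨x, μ⟩‖
      ≤ c₀' * P.mesh 1 * (Real.exp ρ * X) * 2 := by
    intro i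
    rw [pieceR_zero]
    have h := hDG (dip C A ⟨x', ν⟩ (onb N i)) 2 D
      (fun y => by have := norm_dip_le (C := C) (A := A) ⟨x', ν⟩ (onb N i) y; rwa [norm_onb, mul_one] at this)
      (le_max_left _ _) ⟨x, μ⟩ hx hxμ (fun z hz => dip_support_dist C A ν x x' (onb N i) hz)
    refine h.trans ?_
    exact mul_le_mul_of_nonneg_right (mul_le_mul_of_nonneg_left hexp (mul_nonneg hc₀' (P.mesh_pos 1).le)) (by norm_num)
  have hsum : ∑ i : Ix N, ‖covDeriv C A (pieceR C Ω A msq a k 0 (dip C A ⟨x', ν⟩ (onb N i))) ⟨x, μ⟩‖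
      ≤ N * (c₀' * P.mesh 1 * (Real.exp ρ * X) * 2) := by
    refine (Finset.sum_le_sum fun i _ => h1 i).trans ?_
    rw [Finset.sum_const, card_Ix, nsmul_eq_mul]
  unfold mixedTermR
  refine (mul_le_mul_of_nonneg_left (mul_le_mul_of_nonneg_left hsum (inv_nonneg.mpr hm0.le))
    (inv_nonneg.mpr (pow_nonneg hm0.le _))).trans (le_of_eq ?_)
  rw [mesh_eq_pow_mul P 1, pow_one]
  field_simp

/-- **Box piece `1 ≤ j < k`** at two bonds of `Ω`: `ε^{−d}Σ_i‖(D^ε_AG^η_{(j)}(Ω,A)D^{ε*}_A)(x,x′)e_i‖ ≤ N²a²c₀′²c₁·e^{2δ}e^{δ/2}K(δ/2)² · (L^jε)^{−d} ·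
e^{−(δ/2)|x − x′|/L^j}` — p33's `mixedR_piece_pos_le` with the bond hypotheses; scaling `ε^{−d}·ε^{−1}·a_j²(L^jε)^{−4}·(L^jε)^{1+2+1}·L^{−jd}·ε =
a_j²(L^jε)^{−d}`. [cite: Balaban1983Higgs3, (2.6) p.424, (2.10) p.426] [cite: Balaban1982Higgs1, (2.43) p.612, p.611 l.1–2] -/
theorem mixedB_piece_pos_le (ha : 0 < a) (hL1 : 1 < P.L) (hj1 : 1 ≤ j) (hjk : j < k) (hjK : j ≤ P.K) (hmsq : 0 < msq)
    (hΩ : ∀ x x' : HiggsLattice.Site P 0, blockIter j x = blockIter j x' → (x ∈ Ω ↔ x' ∈ Ω))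
    {c₀' c₁ δ : ℝ} (hc₀' : 0 ≤ c₀') (hc₁ : 0 ≤ c₁) (hδ : 0 < δ)
    (hDG : ∀ (g : ScalarField P 0 N) (M D : ℝ), (∀ x, ‖g x‖ ≤ M) → 0 ≤ D →
      ∀ b : HiggsLattice.PBond P 0, b.src ∈ Ω → b.tgt ∈ Ω → (∀ z, g z ≠ 0 → D ≤ (HiggsLattice.Site.tdist b.src z : ℝ)) →
        ‖covDeriv C A (propagatorK C Ω A msq a j g) b‖
          ≤ c₀' * P.mesh j * Real.exp (-(δ * (D / (P.L : ℝ) ^ j))) * M)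
    (hC : ∀ s t : HiggsLattice.Site P j × Ix N, s.1 ∈ levelSet j Ω → t.1 ∈ levelSet j Ω →
      |mat (fluctCovA C Ω A msq a j) s t| ≤ c₁ * P.mesh j ^ 2 * Real.exp (-(δ * (HiggsLattice.Site.tdist s.1 t.1 : ℝ))))
    (μ ν : Fin P.d) {x x' : HiggsLattice.Site P 0} (hx : x ∈ Ω) (hxμ : x.shift μ ∈ Ω) (hx' : x' ∈ Ω) (hx'ν : x'.shift ν ∈ Ω) :
    mixedTermR C Ω A msq a k j μ ν x x'
      ≤ ((N : ℝ) ^ 2 * a ^ 2 * c₀' ^ 2 * c₁ * (Real.exp δ ^ 2 * Real.exp (δ / 2) * profile P N (δ / 2) ^ 2)) *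
        (P.mesh j ^ P.d)⁻¹ *
          Real.exp (-(δ / 2 * ((HiggsLattice.Site.tdist x x' : ℝ) / (P.L : ℝ) ^ j))) := by
  set X := Real.exp (-(δ / 2 * ((HiggsLattice.Site.tdist x x' : ℝ) / (P.L : ℝ) ^ j))) with hX
  have hm0 : 0 < P.mesh 0 := P.mesh_pos 0
  have hmj : 0 < P.mesh j := P.mesh_pos j
  have hLj : (0 : ℝ) < (P.L : ℝ) ^ j := pow_pos (by exact_mod_cast P.hL) j
  have hK : 0 ≤ profile P N (δ / 2) := profile_nonneg' _ (by linarith)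
  have hak : 0 ≤ B1.aSeq a P.L j := (B1.aSeq_pos ha (by exact_mod_cast hL1) hj1).le
  have hDG' : ∀ (g : ScalarField P 0 N) (M D : ℝ), (∀ x, ‖g x‖ ≤ M) → 0 ≤ D →
      ∀ b : HiggsLattice.PBond P 0, b.src ∈ Ω → b.tgt ∈ Ω → (∀ z, g z ≠ 0 → D ≤ (HiggsLattice.Site.tdist b.src z : ℝ)) →
        ‖covDeriv C A (propagatorK C Ω A msq a j g) b‖ ≤ (c₀' * P.mesh j) * Real.exp (-(δ * (D / (P.L : ℝ) ^ j))) * M :=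
    fun g M D hg hD b hb hb' hs => hDG g M D hg hD b hb hb' hs
  have hC' : ∀ s t : HiggsLattice.Site P j × Ix N, s.1 ∈ levelSet j Ω → t.1 ∈ levelSet j Ω →
      |mat (fluctCovA C Ω A msq a j) s t| ≤ (c₁ * P.mesh j ^ 2) * Real.exp (-(δ * (HiggsLattice.Site.tdist s.1 t.1 : ℝ))) :=
    fun s t hs ht => hC s t hs ht
  have hsw : ∀ i : Ix N, ‖covDeriv C A (pieceR C Ω A msq a k j (dip C A ⟨x', ν⟩ (onb N i))) ⟨x, μ⟩‖
      ≤ coeff221 P a j ^ 2 * ((c₀' * P.mesh j * Real.exp δ * Real.sqrt N) ^ 2 * (c₁ * P.mesh j ^ 2) *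
          (((P.L : ℝ) ^ j) ^ P.d)⁻¹ * profile P N (δ / 2) ^ 2 * Real.exp (δ / 2) * (P.mesh 0 * 1) * X) := by
    intro i
    rw [pieceR_of_pos hj1 hjk, LinearMap.smul_apply, covDeriv_smul'', norm_smul, Real.norm_eq_abs,
      abs_of_nonneg (sq_nonneg _)]
    refine mul_le_mul_of_nonneg_left ?_ (sq_nonneg _)
    have h := norm_covDeriv_sandwichR_dip_le_B C Ω A msq a hjK hmsq hak hΩ (by positivity) (by positivity) hδ hDG' hC'
      (c := ⟨x', ν⟩) hx' hx'ν (onb N i) (b := ⟨x, μ⟩) hx hxμ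
    rw [norm_onb] at h
    exact h
  have hsum : ∑ i : Ix N, ‖covDeriv C A (pieceR C Ω A msq a k j (dip C A ⟨x', ν⟩ (onb N i))) ⟨x, μ⟩‖
      ≤ N * (coeff221 P a j ^ 2 * ((c₀' * P.mesh j * Real.exp δ * Real.sqrt N) ^ 2 * (c₁ * P.mesh j ^ 2) *
          (((P.L : ℝ) ^ j) ^ P.d)⁻¹ * profile P N (δ / 2) ^ 2 * Real.exp (δ / 2) * (P.mesh 0 * 1) * X)) := by
    refine (Finset.sum_le_sum fun i _ => hsw i).trans ?_
    rw [Finset.sum_const, card_Ix, nsmul_eq_mul]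
  unfold mixedTermR
  refine (mul_le_mul_of_nonneg_left (mul_le_mul_of_nonneg_left hsum (inv_nonneg.mpr hm0.le))
    (inv_nonneg.mpr (pow_nonneg hm0.le _))).trans ?_
  have hsq : (c₀' * P.mesh j * Real.exp δ * Real.sqrt N) ^ 2 = (c₀' * P.mesh j * Real.exp δ) ^ 2 * N := by
    rw [mul_pow (c₀' * P.mesh j * Real.exp δ), Real.sq_sqrt (Nat.cast_nonneg _)]
  rw [hsq, B1Eq243HiggsModel.coeff221_sq]
  have hid : (P.mesh 0 ^ P.d)⁻¹ * ((P.mesh 0)⁻¹ * (N * (B1.aSeq a (P.L : ℝ) j ^ 2 * (P.mesh j ^ 4)⁻¹ *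
        ((c₀' * P.mesh j * Real.exp δ) ^ 2 * N * (c₁ * P.mesh j ^ 2) *
          (((P.L : ℝ) ^ j) ^ P.d)⁻¹ * profile P N (δ / 2) ^ 2 * Real.exp (δ / 2) * (P.mesh 0 * 1) * X))))
      = B1.aSeq a (P.L : ℝ) j ^ 2 * (((N : ℝ) ^ 2 * c₀' ^ 2 * c₁ *
          (Real.exp δ ^ 2 * Real.exp (δ / 2) * profile P N (δ / 2) ^ 2)) * (P.mesh j ^ P.d)⁻¹ * X) := by
    calc (P.mesh 0 ^ P.d)⁻¹ * ((P.mesh 0)⁻¹ * (N * (B1.aSeq a (P.L : ℝ) j ^ 2 * (P.mesh j ^ 4)⁻¹ *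
          ((c₀' * P.mesh j * Real.exp δ) ^ 2 * N * (c₁ * P.mesh j ^ 2) *
            (((P.L : ℝ) ^ j) ^ P.d)⁻¹ * profile P N (δ / 2) ^ 2 * Real.exp (δ / 2) * (P.mesh 0 * 1) * X))))
        = B1.aSeq a (P.L : ℝ) j ^ 2 * (((N : ℝ) ^ 2 * c₀' ^ 2 * c₁ *
            (Real.exp δ ^ 2 * Real.exp (δ / 2) * profile P N (δ / 2) ^ 2)) * X) *
            ((P.mesh 0 ^ P.d)⁻¹ * (((P.L : ℝ) ^ j) ^ P.d)⁻¹) * ((P.mesh j ^ 4)⁻¹ * P.mesh j ^ 4) *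
            ((P.mesh 0)⁻¹ * P.mesh 0) := by ring
      _ = _ := by
        rw [inv_mesh_zero_pow_mul', inv_mul_cancel₀ (pow_ne_zero 4 hmj.ne'), inv_mul_cancel₀ hm0.ne']; ring
  rw [hid]
  have hrest : 0 ≤ ((N : ℝ) ^ 2 * c₀' ^ 2 * c₁ * (Real.exp δ ^ 2 * Real.exp (δ / 2) * profile P N (δ / 2) ^ 2)) *
      (P.mesh j ^ P.d)⁻¹ * X := by positivity
  calc B1.aSeq a (P.L : ℝ) j ^ 2 * (((N : ℝ) ^ 2 * c₀' ^ 2 * c₁ *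
          (Real.exp δ ^ 2 * Real.exp (δ / 2) * profile P N (δ / 2) ^ 2)) * (P.mesh j ^ P.d)⁻¹ * X)
      ≤ a ^ 2 * (((N : ℝ) ^ 2 * c₀' ^ 2 * c₁ *
          (Real.exp δ ^ 2 * Real.exp (δ / 2) * profile P N (δ / 2) ^ 2)) * (P.mesh j ^ P.d)⁻¹ * X) :=
        mul_le_mul_of_nonneg_right (aSeq_sq_le ha hL1 hj1) hrest
    _ = _ := by ring

end PieceBoundsB

/-! ## §3 The theorem: (2.10) twice differentiated, on cell-product boxes at a regular background, EVERY pair of bonds -/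

section MainB

/-- Rate weakening in a decay factor. [folklore] -/
private theorem exp_rate_mono' {ρ ρ' s : ℝ} (h : ρ' ≤ ρ) (hs : 0 ≤ s) : Real.exp (-(ρ * s)) ≤ Real.exp (-(ρ' * s)) :=
  Real.exp_le_exp.mpr (by nlinarith)

/-- weakening in the exponent. [folklore] -/
private theorem exp_le_exp_of_le''' {u v : ℝ} (h : v ≤ u) : Real.exp (-u) ≤ Real.exp (-v) :=
  Real.exp_le_exp.mpr (neg_le_neg h)

/-- p35's rate `D/(4K₀L^l)` dominates a common rate `δ ≤ 1/(4K₀)` (as in r14's/p33's region members). [cite: Balaban1982Higgs1, Prop. 2.1 (2.25) p.610] -/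
private theorem exp_p35_le''' {K₀ l : ℕ} (hK₀ : 0 < K₀) {δ D : ℝ} (hδ : δ ≤ 1 / (4 * K₀)) (hD : 0 ≤ D)
    (hLl : (0 : ℝ) < (P.L : ℝ) ^ l) :
    Real.exp (-(D / (4 * K₀ * (P.L : ℝ) ^ l))) ≤ Real.exp (-(δ * (D / (P.L : ℝ) ^ l))) := by
  apply exp_le_exp_of_le'''
  have hK : (0 : ℝ) < 4 * K₀ := by positivity
  have h1 : D / (4 * K₀ * (P.L : ℝ) ^ l) = 1 / (4 * K₀) * (D / (P.L : ℝ) ^ l) := by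
    field_simp
  rw [h1]
  exact mul_le_mul_of_nonneg_right hδ (by positivity)

/-- **B3 (2.10) p. 426 [PDF 16], THE TWICE-DIFFERENTIATED CLAUSE, PROVED ON A CELL-PRODUCT BOX OF BIG BLOCKS AT A REGULAR NON-CONSTANT
BACKGROUND `B̃ = A`, AT EVERY PAIR OF BONDS OF THE BOX, uniformly in the volume — ONE SMALLNESS PARAMETER.**  For `d ≥ 1`, `L ≥ 2`, `a, m² > 0`,
`N` and EVERY charge there is a threshold `K₀,min` and, for every cube size `K₀ ≥ K₀,min`, constants `t, δ₁, C > 0` such that: for every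
volume `P` with these `d, L` and `K₀ ∣ M`, every scale `1 ≤ k ≤ K` with `L^kε ≤ 1` and `3L^kK₀ ≤ |T_ε|_μ`, every cell-product box
`Ω = cellBox k K₀ S`, every configuration `A` that is `δ_A`-REGULAR ON `Ω` with `L^k·δ_A·|e| ≤ t`: for all pieces `j`, all directions `μ, ν` and
ALL `x, x′` with the bonds `⟨x, x+εe_μ⟩`, `⟨x′, x′+εe_ν⟩` inside `Ω`,
`ε^{−d}Σ_i‖(D^ε_{A,μ}G^η_{(j)}D^{ε*}_{A,ν})(Ω, A; x, x′)e_i‖ ≤ C(L^jη)^{−d}e^{−δ₁(L^jη)^{−1}|x−x′|}` — *«For some simple sets Ω, e.g. for rectangular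
parallelepipeds, the inequalities hold without any restrictions on the points x, x′»* (part I p. 611 l.1–2) carried into the differentiated
clause of (2.10).  Route = p33's `ineq210_mixed_regularRegion` with the (I.2.25) derivative input replaced by the `R₀`-free box member
(`B3Ineq210RegularBox.norm_covDeriv_propagatorK_box_reg_decay_sum`, every bond of `Ω`) read at every level `l ≤ k` through
`cellBox_eq_cellBox_of_le`.  Honest scope: module docstring.
[cite: Balaban1983Higgs3, (2.6) p.424, (2.10) p.426] [cite: Balaban1982Higgs1, Prop. 2.1 (2.23), (2.25) p.610, p.611 l.1–2, Prop. 2.3 (2.34)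
p.611, (2.43) p.612] -/
theorem ineq210_mixed_regularBox (d L : ℕ) (hd : 1 ≤ d) (hL : 2 ≤ L) {a : ℝ} (ha : 0 < a) {msq : ℝ} (hmsq : 0 < msq)
    (N : ℕ) (C : ChargeData N) :
    ∃ K₀min : ℕ, ∀ K₀ : ℕ, K₀min ≤ K₀ → ∃ t δ₁ Cst : ℝ, 0 < t ∧ 0 < δ₁ ∧ 0 < Cst ∧
      ∀ (P : HiggsLattice.Params), P.d = d → P.L = L → K₀ ∣ P.M →
      ∀ {k : ℕ}, 1 ≤ k → k ≤ P.K → (∀ μ, 3 * half P k K₀ ≤ P.sitesPerDir 0 μ) → P.mesh k ≤ 1 →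
      ∀ (S : Fin P.d → Finset ℕ) (A : HiggsLattice.VecField P 0) {δA : ℝ}, 0 ≤ δA →
        (∀ z ∈ cellBox k K₀ S, ∀ μ ν : Fin P.d, |A ⟨z.shift ν, μ⟩ - A ⟨z, μ⟩| ≤ δA) →
        (P.L : ℝ) ^ k * δA * |C.e| ≤ t →
        ∀ (j : ℕ) (μ ν : Fin P.d) (x x' : HiggsLattice.Site P 0),
          x ∈ cellBox k K₀ S → x.shift μ ∈ cellBox k K₀ S → x' ∈ cellBox k K₀ S → x'.shift ν ∈ cellBox k K₀ S →
          mixedTermR C (cellBox k K₀ S) A msq a k j μ ν x x'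
            ≤ Cst * (P.mesh j ^ P.d)⁻¹ * Real.exp (-(δ₁ * ((HiggsLattice.Site.tdist x x' : ℝ) / (P.L : ℝ) ^ j))) := by
  have hL1 : 1 < L := by omega
  obtain ⟨t₀, c₁, ρ₃, ht₀, hc₁, hρ₃, hCov⟩ := B1Prop23RegularRegionSmall.prop23_regular_region_small d L hL1 ha hmsq N
  obtain ⟨K₂, hD⟩ := norm_covDeriv_propagatorK_box_reg_decay_sum d L hd hL ha hmsq N C 1 1 1 zero_le_one one_pos
  refine ⟨max K₂ 1, fun K₀ hK₀ => ?_⟩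
  have hK₂ : K₂ ≤ K₀ := (le_max_left _ _).trans hK₀
  have hK₀1 : 1 ≤ K₀ := (le_max_right _ _).trans hK₀
  obtain ⟨c₀', e₂, hc₀', he₂, hD⟩ := hD K₀ hK₂
  obtain ⟨δ, hδ⟩ : ∃ δ : ℝ, δ = min (1 / (4 * (K₀ : ℝ))) ρ₃ := ⟨_, rfl⟩
  have hδpos : 0 < δ := by rw [hδ]; exact lt_min (by positivity) hρ₃
  have hδ₁ : δ ≤ 1 / (4 * K₀) := by rw [hδ]; exact min_le_left _ _
  have hδ₃ : δ ≤ ρ₃ := by rw [hδ]; exact min_le_right _ _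
  have hLpos : (0 : ℝ) < L := by exact_mod_cast (by omega : 0 < L)
  refine ⟨min e₂ t₀, δ / (2 * L), cstMix d L N a c₀' c₁ δ, lt_min he₂ ht₀, div_pos hδpos (by positivity),
    cstMix_pos hc₀'.le hc₁.le, ?_⟩
  intro P hPd hPL hK₀M k hk1 hkK h3 hmesh S A δA hδA hreg ht j μ ν x x' hx hxμ hx' hx'ν
  subst hPd hPL
  set Ω : Finset (HiggsLattice.Site P 0) := cellBox k K₀ S with hΩdef
  have hL1' : 1 < P.L := hL1
  have hLr : 1 < (P.L : ℝ) := by exact_mod_cast hL1'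
  have hLge1 : (1 : ℝ) ≤ P.L := hLr.le
  have hCst : 0 ≤ cstMix P.d P.L N a c₀' c₁ δ := (cstMix_pos hc₀'.le hc₁.le).le
  have hte₂ : (P.L : ℝ) ^ k * δA * |C.e| ≤ e₂ := ht.trans (min_le_left _ _)
  have htt₀ : (P.L : ℝ) ^ k * δA * |C.e| ≤ t₀ := ht.trans (min_le_right _ _)
  have hΩ : IsBigBlockUnion k K₀ Ω := isBigBlockUnion_cellBox S
  have hΩl : ∀ {l : ℕ}, l ≤ k → ∀ x x' : HiggsLattice.Site P 0, blockIter l x = blockIter l x' → (x ∈ Ω ↔ x' ∈ Ω) :=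
    fun hl => blockUnion_of_isBigBlockUnion hl hΩ
  have hΩeq : ∀ {l : ℕ}, l ≤ k → cellBox l K₀ (refineS P k l S) = Ω := fun hl => (cellBox_eq_cellBox_of_le hl S).symm
  -- (I.2.25) derivative at level `l`, engine form, at EVERY bond of `Ω`
  have hDl : ∀ {l : ℕ}, 1 ≤ l → l ≤ k → ∀ (g : ScalarField P 0 N) (M D : ℝ), (∀ x, ‖g x‖ ≤ M) → 0 ≤ D →
      ∀ b : HiggsLattice.PBond P 0, b.src ∈ Ω → b.tgt ∈ Ω → (∀ z, g z ≠ 0 → D ≤ (HiggsLattice.Site.tdist b.src z : ℝ)) →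
        ‖covDeriv C A (propagatorK C Ω A msq a l g) b‖
          ≤ c₀' * P.mesh l * Real.exp (-(δ * (D / (P.L : ℝ) ^ l))) * M := by
    intro l hl1 hlk g M D hg hD0 b hb hb' hsupp
    have hmesh_l : P.mesh l ≤ 1 := (mesh_mono P hlk).trans hmesh
    have h3l : ∀ μ, 3 * half P l K₀ ≤ P.sitesPerDir 0 μ := fun μ => (Nat.mul_le_mul_left _ (half_mono hlk)).trans (h3 μ)
    have hak : 0 ≤ B1.aSeq a P.L l := (B1.aSeq_pos ha hLr hl1).le
    have h0 := hD P rfl rfl hK₀M hl1 (hlk.trans hkK) h3l hmesh_l (refineS P k l S) A he₂ le_rfl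
    rw [hΩeq hlk] at h0
    have h := h0 (reg223R_of_small C Ω A hlk hmesh_l he₂ hδA hreg hte₂ le_rfl) b.src b.dir hb hb' g M D hg hD0 hsupp
    have hcut : ∀ y ∈ Ω, propagatorK C Ω A msq a l (chi Ω • g) y = propagatorK C Ω A msq a l g y :=
      fun y hy => (propagatorK_apply_eq_chi C A hmsq hak (hΩl hlk) g hy).symm
    have hbb : (⟨b.src, b.dir⟩ : HiggsLattice.PBond P 0) = b := rfl
    rw [hbb] at h
    have hb'' : covDeriv C A (propagatorK C Ω A msq a l (chi Ω • g)) b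
        = covDeriv C A (propagatorK C Ω A msq a l g) b := by
      have h1 : propagatorK C Ω A msq a l (chi Ω • g) b.tgt = propagatorK C Ω A msq a l g b.tgt := hcut _ hb'
      have h2 : propagatorK C Ω A msq a l (chi Ω • g) b.src = propagatorK C Ω A msq a l g b.src := hcut _ hb
      rw [B1Cor23RegularRegion.covDeriv_eq, B1Cor23RegularRegion.covDeriv_eq, h1, h2]
    rw [hb''] at h
    refine h.trans ?_
    have hM : 0 ≤ M := (norm_nonneg _).trans (hg b.src)
    have hml : 0 < P.mesh l := P.mesh_pos l
    have hLl : (0 : ℝ) < (P.L : ℝ) ^ l := pow_pos (by exact_mod_cast P.hL) l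
    have hexp := exp_p35_le''' (P := P) (by omega : 0 < K₀) hδ₁ hD0 hLl
    exact mul_le_mul_of_nonneg_right (mul_le_mul_of_nonneg_left hexp (by positivity)) hM
  -- (I.2.34) at level `l < k` on `Ω^{(l)} × Ω^{(l)}` (p35's `prop23_regular_region_small`), as in r14's/p33's members
  have hCl : ∀ {l : ℕ}, 1 ≤ l → l < k → ∀ s t : HiggsLattice.Site P l × Ix N, s.1 ∈ levelSet l Ω → t.1 ∈ levelSet l Ω →
      |mat (fluctCovA C Ω A msq a l) s t| ≤ c₁ * P.mesh l ^ 2 * Real.exp (-(δ * (HiggsLattice.Site.tdist s.1 t.1 : ℝ))) := by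
    intro l hl1 hlk s t hs ht'
    obtain ⟨j, rfl⟩ : ∃ j, l = j + 1 := ⟨l - 1, by omega⟩
    have hmesh_l : P.mesh (j + 1) ≤ 1 := (mesh_mono P hlk.le).trans hmesh
    have hjK : j + 1 < P.K := lt_of_lt_of_le hlk hkK
    have htl : (P.L : ℝ) ^ (j + 1) * δA * |C.e| ≤ t₀ := by
      have hpow : (P.L : ℝ) ^ (j + 1) ≤ (P.L : ℝ) ^ k := pow_le_pow_right₀ hLge1 hlk.le
      have h0 : 0 ≤ δA * |C.e| := by positivity
      calc (P.L : ℝ) ^ (j + 1) * δA * |C.e| = (P.L : ℝ) ^ (j + 1) * (δA * |C.e|) := by ring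
        _ ≤ (P.L : ℝ) ^ k * (δA * |C.e|) := mul_le_mul_of_nonneg_right hpow h0
        _ = (P.L : ℝ) ^ k * δA * |C.e| := by ring
        _ ≤ t₀ := htt₀
    have hjk : j < k := by omega
    have hpf : pieceF (towerR Ω k) ⟨j, hjk⟩ = Ω := pieceF_towerR ⟨j, hjk⟩ (hΩl hlk.le)
    have hregF : ∀ z ∈ pieceF (towerR Ω k) ⟨j, hjk⟩, ∀ μ' ν' : Fin P.d, |A ⟨z.shift ν', μ'⟩ - A ⟨z, μ'⟩| ≤ δA := by
      rw [hpf]; exact hreg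
    have hj2 : j + 2 ≤ k := by omega
    have hΛ := levelSet_blockUnion hjK.le (hΩl hlk.le) (hΩl hj2)
    have h := (hCov C P rfl rfl (towerR Ω k) hkK ⟨j, hjk⟩ hjK hmesh_l hΛ A hδA hregF htl (Λ := levelSet (j + 1) Ω)
      (subset_refl _) hs ht').1
    rw [hpf, mat_condCov232_levelSet C A hjK.le hmsq ha hLr (hΩl hlk.le) (hΩl hj2) hs] at h
    refine h.trans ?_
    have hexp : Real.exp (-(ρ₃ * (HiggsLattice.Site.tdist s.1 t.1 : ℝ))) ≤ Real.exp (-(δ * (HiggsLattice.Site.tdist s.1 t.1 : ℝ))) :=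
      exp_le_exp_of_le''' (mul_le_mul_of_nonneg_right hδ₃ (Nat.cast_nonneg _))
    calc P.mesh (j + 1) ^ 2 * c₁ * Real.exp (-(ρ₃ * (HiggsLattice.Site.tdist s.1 t.1 : ℝ)))
        ≤ P.mesh (j + 1) ^ 2 * c₁ * Real.exp (-(δ * (HiggsLattice.Site.tdist s.1 t.1 : ℝ))) :=
          mul_le_mul_of_nonneg_left hexp (by positivity)
      _ = _ := by ring
  -- rate bookkeeping
  have hrate : δ / (2 * P.L) ≤ δ / 2 := by
    rw [div_le_div_iff₀ (by positivity) (by norm_num : (0 : ℝ) < 2)]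
    nlinarith
  have hexp0 : Real.exp (-(δ * ((HiggsLattice.Site.tdist x x' : ℝ) / (P.L : ℝ) ^ 1)))
      ≤ Real.exp (-(δ / (2 * P.L) * ((HiggsLattice.Site.tdist x x' : ℝ) / (P.L : ℝ) ^ 0))) := by
    apply exp_le_exp_of_le'''
    rw [pow_one, pow_zero, div_one]
    have h0 : 0 ≤ δ * ((HiggsLattice.Site.tdist x x' : ℝ) / P.L) := by positivity
    calc δ / (2 * P.L) * (HiggsLattice.Site.tdist x x' : ℝ) = (1 / 2) * (δ * ((HiggsLattice.Site.tdist x x' : ℝ) / P.L)) := by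
          ring
      _ ≤ δ * ((HiggsLattice.Site.tdist x x' : ℝ) / P.L) := by linarith
  have hexpj : Real.exp (-(δ / 2 * ((HiggsLattice.Site.tdist x x' : ℝ) / (P.L : ℝ) ^ j)))
      ≤ Real.exp (-(δ / (2 * P.L) * ((HiggsLattice.Site.tdist x x' : ℝ) / (P.L : ℝ) ^ j))) :=
    exp_rate_mono' hrate (by positivity)
  have hmj : 0 < P.mesh j := P.mesh_pos j
  rcases Nat.eq_zero_or_pos j with rfl | hj1
  · refine (mixedB_piece_zero_le C Ω A msq (k := k) hc₀'.le hδpos.le (hDl le_rfl hk1) μ ν hx hxμ x').trans ?_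
    rw [pow_zero] at hexp0 ⊢
    exact mul_le_mul (mul_le_mul_of_nonneg_right (le_cstMix_zero hc₀'.le hc₁.le) (by positivity)) hexp0
      (Real.exp_pos _).le (by positivity)
  · by_cases hjk : j < k
    · refine (mixedB_piece_pos_le C Ω A msq ha hL1' hj1 hjk (hjk.le.trans hkK) hmsq (hΩl hjk.le) hc₀'.le hc₁.le
        hδpos (hDl hj1 hjk.le) (hCl hj1 hjk) μ ν hx hxμ hx' hx'ν).trans ?_
      exact mul_le_mul (mul_le_mul_of_nonneg_right (le_cstMix_pos hc₀'.le hc₁.le) (by positivity)) hexpj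
        (Real.exp_pos _).le (by positivity)
    · rw [mixedTermR_eq_zero_of_le C Ω A msq hj1 (not_lt.mp hjk)]
      positivity

end MainB

end Literature.MathematicalPhysics.QuantumFieldTheory.Balaban1983to89.B3Ineq210MixedRegularBox

end
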